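import Literature.Computability.Complexity.TruncMapMachine
import Literature.Computability.Complexity.NondeterministicProofs
import Literature.Computability.Complexity.BranchingFn
import Literature.Computability.Complexity.NSubexp
import HarnessLib

/-!
# `DTIME ⊆ NTIME` in the tree's verifier form; `P ⊆ NTIME(2ⁿ)`

Literature / complexity toolkit (serves the decomposition of Williams' transfer theorem,
`Williams2014Transfer.lean`, named glue fact `P_subset_NTIME_two_pow`). The tree's `NTIME t`
(`Nondeterministic.lean`) is in verifier form with ONE constant `c` bounding both the admissible
witnesses, `|y| ≤ c · t |x| + c`, and the time of the verifier on the pair word `⟨x, y⟩`, whose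
length `2|x| + 2 + |y|` exceeds the budget for maximal witnesses; so even the trivial verifier of
a deterministic decider ("ignore the certificate", Arora–Barak 2009, Claim 2.4) must DISCARD the
certificate two symbols per step. The tree's truncating wrapper `truncMapAux`
(`TruncMapMachine.lean`) does exactly this; here we draw the class-level consequences:

* `mem_NTIME_of_timeDecidable` — if `L` is decided within `T n` steps and every
  `p(n) + T(n)` (`p` a polynomial) is `≤ b · t n + b`, then `L ∈ NTIME t`: the verifier is
  `truncMapAux N` for the clock `N : x ↦ ⟨x, ε⟩` (keep nothing of the witness), composed
  (`Turing.TM2ComputableAux.comp`, additive time) with the decider behind the pair projection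
  (`boolUnpairFstLift`, `NondeterministicProofs.lean`); its time on `⟨x, y⟩` is
  `poly(n) + T(n) + |y| / 2`, and with `c' = 2b + 2` both clauses of `NTIME t` hold;
* `DTIME_subset_NTIME_of_dominated` — `DTIME T ⊆ NTIME t` under the same domination for
  `a · T + a`;
* **`P_subset_NTIME_two_pow_thm : P ⊆ NTIME (2 ^ ·)`** and
  `DTIME_two_pow_subset_NTIME_two_pow : DTIME (2 ^ ·) ⊆ NTIME (2 ^ ·)`.

## References

* S. Arora, B. Barak, *Computational Complexity: A Modern Approach*, CUP 2009, Claim 2.4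
  (`P ⊆ NP`: "take `p(x)` the zero polynomial (in other words, `u` is an empty string)"),
  Def. 2.1 and §2.1.2 (verifier form of nondeterministic time), §1.3 (several operations per
  step; linear speed-up).
-/

namespace Literature.Computability.Complexity

open _root_.Computability Turing Polynomial

/-- The clock `x ↦ ⟨x, ε⟩` ("keep nothing of the witness") is computed by some machine in
polynomial time. [folklore] -/
theorem exists_machine_pair_nil :
    ∃ (q : Polynomial ℕ) (N : TM2ComputableAux Bool Bool),
      ∀ x : List Bool, N.OutputsWithin x (boolPair x []) (q.eval x.length) := by
  have h : fanoutFn id (fun _ => ([] : List Bool)) ∈ FP :=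
    fanoutFn_mem_FP OracleCompose.id_mem_FP (const_mem_FP [])
  obtain ⟨q, N, hN⟩ := h
  refine ⟨q, N, fun x => ?_⟩
  have := hN x
  simpa [fanoutFn_apply] using this

/-- **A deterministic decider is a verifier that discards its certificate** (Arora–Barak 2009,
Claim 2.4, in the tree's one-constant verifier form of `NTIME`): if `L` is decided within `T n`
steps on inputs of length `n`, and `p(n) + T(n) ≤ b · t n + b` for every polynomial `p` (some
`b = b(p)`), then `L ∈ NTIME t`. The verifier is the truncating wrapper `truncMapAux N` of
`TruncMapMachine.lean` for the clock `N : x ↦ ⟨x, ε⟩` — it reads the discarded witness two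
symbols per step, `|y| / 2 + poly(n)` steps — followed by the decider run on the first component
(`boolUnpairFstLift`); the relation is `R x y = [x ∈ L]`, the witness `y = ε` always suffices,
and the constant is `2b + 2`. [cite: AroraBarak2009, Claim 2.4] -/
theorem mem_NTIME_of_timeDecidable {L : Language Bool} {T t : ℕ → ℕ}
    (hL : TimeDecidable id L T)
    (hdom : ∀ p : Polynomial ℕ, ∃ b : ℕ, ∀ n, p.eval n + T n ≤ b * t n + b) : L ∈ NTIME t := by
  obtain ⟨M, hM⟩ := hL
  obtain ⟨q, N, hN⟩ := exists_machine_pair_nil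
  obtain ⟨b, hb⟩ := hdom (q + 7 * X + 16)
  -- the verifier: truncate the witness to nothing, then decide `x`
  let V : TM2ComputableAux Bool Bool := (truncMapAux N).comp (boolUnpairFstLift M)
  refine ⟨2 * b + 2, fun x _ => L.boolIndicator x, V, fun x y hy => ?_, fun x => ?_⟩
  · -- running time
    have h₁ := outputsWithin_truncMapAux_boolPair N (y := y) (hN x)
    simp only [List.length_nil, List.take_zero, mul_zero, add_zero] at h₁
    have h₂ : (boolUnpairFstLift M).OutputsWithin (boolPair x [])
        (encodeBool (L.boolIndicator x)) (T x.length + ((boolPair x []).length + 3)) := by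
      refine outputsWithin_boolUnpairFstLift M ?_
      have := hM x
      simpa using this
    have h := Turing.TM2ComputableAux.comp_outputsWithin _ _ h₁ h₂
    refine h.mono ?_
    have hbn := hb x.length
    simp only [eval_add, eval_mul, eval_ofNat, eval_X] at hbn
    have hlen : (boolPair x ([] : List Bool)).length = 2 * x.length + 2 := by simp
    rw [hlen]
    have hy2 : 2 * (y.length / 2) ≤ (2 * b + 2) * t x.length + (2 * b + 2) :=
      (Nat.mul_div_le y.length 2).trans hy
    nlinarith [hbn, hy2]
  · -- correctness: the empty witness
    have hiff : x ∈ L ↔ L.boolIndicator x = true :=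
      Set.mem_iff_boolIndicator (L : Set (List Bool)) x
    exact ⟨fun h => ⟨[], Nat.zero_le _, hiff.1 h⟩, fun ⟨_, _, h⟩ => hiff.2 h⟩

/-- **`DTIME T ⊆ NTIME t`** whenever every `p(n) + a · T(n) + a` (`p` a polynomial, `a` a
constant) is `≤ b · t n + b` — in particular whenever `T` itself is a polynomial or `t`
dominates `T` and all polynomials (Arora–Barak 2009, Claim 2.4 / Thm. 2.6:
`DTIME(T) ⊆ NTIME(T)`). [cite: AroraBarak2009, Claim 2.4] -/
theorem DTIME_subset_NTIME_of_dominated {T t : ℕ → ℕ}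
    (h : ∀ (a : ℕ) (p : Polynomial ℕ), ∃ b : ℕ, ∀ n, p.eval n + (a * T n + a) ≤ b * t n + b) :
    DTIME T ⊆ NTIME t := by
  rintro L ⟨a, hL⟩
  exact mem_NTIME_of_timeDecidable (show TimeDecidable id L (fun n => a * T n + a) from hL) (h a)

/-- **`P ⊆ NTIME(2ⁿ)`** (Arora–Barak 2009, Claim 2.4 with `nᵏ = O(2ⁿ)`): the statement of the
named glue fact `P_subset_NTIME_two_pow` of `Williams2014Transfer.lean`.
[cite: AroraBarak2009, Claim 2.4] -/
theorem P_subset_NTIME_two_pow_thm : Classes.P ⊆ NTIME (fun n => 2 ^ n) := by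
  intro L hL
  simp only [Classes.P, Set.mem_iUnion] at hL
  obtain ⟨k, hk⟩ := hL
  refine DTIME_subset_NTIME_of_dominated (fun a p => ?_) hk
  obtain ⟨b, hb⟩ := TimeConstructible.exists_poly_le_two_pow_pow (p + (C a * X ^ k + C a)) le_rfl
  refine ⟨b, fun n => ?_⟩
  have := hb n
  simpa using this

/-- **`DTIME(2ⁿ) ⊆ NTIME(2ⁿ)`** (Arora–Barak 2009, Claim 2.4 / §2.1.2: deterministic time is
nondeterministic time). [cite: AroraBarak2009, Claim 2.4] -/
theorem DTIME_two_pow_subset_NTIME_two_pow :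
    DTIME (fun n => 2 ^ n) ⊆ NTIME (fun n => 2 ^ n) := by
  refine DTIME_subset_NTIME_of_dominated fun a p => ?_
  obtain ⟨b, hb⟩ := TimeConstructible.exists_poly_le_two_pow_pow p le_rfl
  refine ⟨b + a, fun n => ?_⟩
  have := hb n
  simp only [pow_one] at this
  nlinarith [this, Nat.one_le_two_pow (n := n)]

end Literature.Computability.Complexity
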